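import Literature.NumberTheory.Transcendental.AnalytificationFunctorialityProofs
import Literature.NumberTheory.Transcendental.AbelianVarietyAnalyticLieGroup
import Literature.AlgebraicGeometry.FundamentalGroup.RiemannExistenceEtaleLocalHomeomorph
import Literature.Topology.Euclidean.InvarianceOfDimension
import Literature.Analysis.Complex.InjectiveHolomorphic
import HarnessLib

/-!
# Analytified morphisms of smooth complex varieties are `C^ω`; analytified ÉTALE morphisms are local biholomorphisms

Topic `Literature/NumberTheory/Transcendental`, namespace `Literature.NumberTheory.Transcendental` (grouping
sub-namespace `IsAnalytification`).  THEOREMS ONLY.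

Let `φ : M → X(ℂ)`, `ψ : M' → Y(ℂ)` be analytifications with holomorphic atlases (★ `IsAnalytification`) of smooth
`ℂ`-schemes `X`, `Y` of relative dimensions `d`, `e`, `g : X ⟶ Y` a morphism and `h : M → M'` THE analytified map
(`ψ ∘ h = g(ℂ) ∘ φ`).

* `IsAnalytification.contMDiff_comp_map` — `h` is `C^ω` [SerreGAGA1956, §2 n°5 Prop. 2 «toute application régulière
  est holomorphe»]: ★ `mdifferentiable_comp_map_holds` (holomorphic) + ★ `contMDiff_omega_of_mdifferentiable` (Osgood).
* `IsAnalytification.isLocalHomeomorph_comp_map_of_etale` — for `g` ÉTALE, `h` is a local homeomorphism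
  [SGA1, Exp. XII Prop. 3.1 (iii)]: ★ `isLocalHomeomorph_map_of_etale` transported through the homeomorphisms `φ`, `ψ`.
* `IsAnalytification.bijective_mfderiv_comp_map_of_etale` — for `g` ÉTALE, the differential `mfderiv h m` is
  BIJECTIVE at every point («`f` étale ⇔ `f^an` isomorphisme local», [SGA1, Exp. XII Prop. 3.1 (iii)]; tangent level
  by Clements–Osgood [FritzscheGrauert2002, Ch. I §8 Thm. 8.5]: read in charts, `h` is an injective holomorphic map
  between open subsets of complex vector spaces of the same dimension (invariance of dimension, ★
  `finrank_complex_eq_of_openPartialHomeomorph`), so its derivative is bijective, ★ `SCV.bijective_fderiv_of_injOn`).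

Used by the floor-0 programme P6 (crux `HLiu418`) L8-PREP road B, organ B1 «DOUBLING»: the analytified doubling map
`[2]^an` of an abelian scheme is `C^ω` with bijective differential (`[2]` is étale in characteristic `0`), and the
analytified identity section is `C^ω`.  HOME-only prep; count-neutral.

## References
* [SerreGAGA1956] J.-P. Serre, *Géométrie algébrique et géométrie analytique*, Ann. Inst. Fourier 6 (1956), §2 n°5 Prop. 2.
* [SGA1] A. Grothendieck, *SGA 1*, LNM 224, Exp. XII Prop. 3.1 (iii).
* [FritzscheGrauert2002] K. Fritzsche, H. Grauert, *From Holomorphic Functions to Complex Manifolds*, GTM 213, Ch. I §8 Thm. 8.5.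
-/

noncomputable section

open CategoryTheory AlgebraicGeometry Set Function
open scoped Manifold ContDiff Topology

namespace Literature.NumberTheory.Transcendental

open Literature.AlgebraicGeometry.Motives (ComplexPoints AlgPoints SchemeOver)
open Literature.AlgebraicGeometry.Motives.AlgPoints

namespace IsAnalytification

variable {E : Type*} [NormedAddCommGroup E] [NormedSpace ℂ E] [FiniteDimensional ℂ E]
  {E' : Type*} [NormedAddCommGroup E'] [NormedSpace ℂ E'] [FiniteDimensional ℂ E']
  {M : Type*} [TopologicalSpace M] [ChartedSpace E M] [IsManifold 𝓘(ℂ, E) ω M]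
  {M' : Type*} [TopologicalSpace M'] [ChartedSpace E' M'] [IsManifold 𝓘(ℂ, E') ω M']
  {X Y : SchemeOver ℂ} {d e : ℕ} {φ : M → ComplexPoints X} {ψ : M' → ComplexPoints Y}
  [LocallyOfFiniteType X.hom] [LocallyOfFiniteType Y.hom]
  [SmoothOfRelativeDimension d X.hom] [SmoothOfRelativeDimension e Y.hom]

/-- **Analytified morphisms are `C^ω`** [Serre, GAGA §2 n°5 Prop. 2]: if `ψ ∘ h = g(ℂ) ∘ φ` for analytifications
`φ`, `ψ` of smooth `ℂ`-schemes and a morphism `g : X ⟶ Y`, then `h` is `C^ω`.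
[cite: SerreGAGA1956, §2 n°5 Prop. 2] -/
theorem contMDiff_comp_map (hφ : IsAnalytification E X d φ) (hψ : IsAnalytification E' Y e ψ) (g : X ⟶ Y)
    (h : M → M') (hh : ψ ∘ h = AlgPoints.map g ∘ φ) : ContMDiff 𝓘(ℂ, E) 𝓘(ℂ, E') ω h := by
  haveI : CompleteSpace E' := FiniteDimensional.complete ℂ E'
  exact contMDiff_omega_of_mdifferentiable (mdifferentiable_comp_map_holds hφ hψ g h hh)

omit [IsManifold 𝓘(ℂ, E) ω M] [IsManifold 𝓘(ℂ, E') ω M'] [LocallyOfFiniteType X.hom] [LocallyOfFiniteType Y.hom]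
  [SmoothOfRelativeDimension d X.hom] [SmoothOfRelativeDimension e Y.hom] in
/-- The analytified map is `ψ⁻¹ ∘ g(ℂ) ∘ φ`. [cite: SerreGAGA1956, §2 n°5] -/
theorem comp_map_eq (hφ : IsAnalytification E X d φ) (hψ : IsAnalytification E' Y e ψ) (g : X ⟶ Y)
    (h : M → M') (hh : ψ ∘ h = AlgPoints.map g ∘ φ) :
    h = hψ.homeomorph.symm ∘ AlgPoints.map g ∘ hφ.homeomorph := by
  funext m
  apply hψ.homeomorph.injective
  rw [Function.comp_apply, Function.comp_apply, Homeomorph.apply_symm_apply, coe_homeomorph, coe_homeomorph]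
  exact congrFun hh m

omit [IsManifold 𝓘(ℂ, E) ω M] [IsManifold 𝓘(ℂ, E') ω M'] [LocallyOfFiniteType X.hom] [LocallyOfFiniteType Y.hom]
  [SmoothOfRelativeDimension d X.hom] [SmoothOfRelativeDimension e Y.hom] in
/-- **Analytified ÉTALE morphisms are local homeomorphisms** [SGA1, XII Prop. 3.1 (iii)].
[cite: SGA1, Exp. XII Prop. 3.1 (iii)] -/
theorem isLocalHomeomorph_comp_map_of_etale (hφ : IsAnalytification E X d φ) (hψ : IsAnalytification E' Y e ψ)
    (g : X ⟶ Y) [Etale g.left] (h : M → M') (hh : ψ ∘ h = AlgPoints.map g ∘ φ) : IsLocalHomeomorph h := by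
  rw [comp_map_eq hφ hψ g h hh]
  exact hψ.homeomorph.symm.isLocalHomeomorph.comp
    ((Literature.AlgebraicGeometry.FundamentalGroup.isLocalHomeomorph_map_of_etale g).comp
      hφ.homeomorph.isLocalHomeomorph)

/-- **Analytified ÉTALE morphisms are local biholomorphisms: the differential is bijective everywhere**
[SGA1, XII Prop. 3.1 (iii)] («`f` étale ⇔ `f^an` isomorphisme local»), tangent level by Clements–Osgood
[FritzscheGrauert2002, I §8 Thm. 8.5].
[cite: SGA1, Exp. XII Prop. 3.1 (iii)] [cite: FritzscheGrauert2002, Ch. I §8 Thm. 8.5] -/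
theorem bijective_mfderiv_comp_map_of_etale (hφ : IsAnalytification E X d φ) (hψ : IsAnalytification E' Y e ψ)
    (g : X ⟶ Y) [Etale g.left] (h : M → M') (hh : ψ ∘ h = AlgPoints.map g ∘ φ) (m : M) :
    Bijective (mfderiv 𝓘(ℂ, E) 𝓘(ℂ, E') h m) := by
  classical
  haveI : IsManifold 𝓘(ℂ, E) 1 M := inferInstance
  haveI : IsManifold 𝓘(ℂ, E') 1 M' := inferInstance
  have hmd : MDifferentiable 𝓘(ℂ, E) 𝓘(ℂ, E') h := mdifferentiable_comp_map_holds hφ hψ g h hh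
  have hloc : IsLocalHomeomorph h := isLocalHomeomorph_comp_map_of_etale hφ hψ g h hh
  have hcont : Continuous h := hmd.continuous
  -- a local homeomorphism `e₀` agreeing with `h` near `m`
  obtain ⟨e₀, hme₀, he₀⟩ := hloc m
  -- charts
  set cx := chartAt E m with hcx
  set cy := chartAt E' (h m) with hcy
  -- the chart expression `F = cy ∘ h ∘ cx.symm` and the open set on which it is injective and holomorphic
  set F : E → E' := extChartAt 𝓘(ℂ, E') (h m) ∘ h ∘ (extChartAt 𝓘(ℂ, E) m).symm with hF
  set U : Set E := (extChartAt 𝓘(ℂ, E) m).target ∩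
      (extChartAt 𝓘(ℂ, E) m).symm ⁻¹' (h ⁻¹' (extChartAt 𝓘(ℂ, E') (h m)).source) with hU
  have hUo : IsOpen U :=
    (continuousOn_extChartAt_symm m).isOpen_inter_preimage (isOpen_extChartAt_target m)
      (hcont.isOpen_preimage _ (isOpen_extChartAt_source (h m)))
  have hFd : DifferentiableOn ℂ F U := (mdifferentiable_iff.1 hmd).2 m (h m)
  -- shrink to where `h = e₀` is injective
  set U' : Set E := U ∩ (extChartAt 𝓘(ℂ, E) m).symm ⁻¹' e₀.source with hU'
  have hU'o : IsOpen U' := by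
    have : IsOpen ((extChartAt 𝓘(ℂ, E) m).target ∩ (extChartAt 𝓘(ℂ, E) m).symm ⁻¹' e₀.source) :=
      (continuousOn_extChartAt_symm m).isOpen_inter_preimage (isOpen_extChartAt_target m) e₀.open_source
    convert hUo.inter this using 1
    ext z; simp only [hU', hU, mem_inter_iff, mem_preimage]; tauto
  have hxU' : extChartAt 𝓘(ℂ, E) m m ∈ U' := by
    refine ⟨⟨mem_extChartAt_target m, ?_⟩, ?_⟩
    · simp only [mem_preimage, extChartAt_to_inv]; exact mem_extChartAt_source (h m)
    · simp only [mem_preimage, extChartAt_to_inv]; exact hme₀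
  have hFd' : DifferentiableOn ℂ F U' := hFd.mono inter_subset_left
  have hFinj : InjOn F U' := by
    intro a ha b hb hab
    have ha1 : (extChartAt 𝓘(ℂ, E) m).symm a ∈ e₀.source := ha.2
    have hb1 : (extChartAt 𝓘(ℂ, E) m).symm b ∈ e₀.source := hb.2
    have ha2 : h ((extChartAt 𝓘(ℂ, E) m).symm a) ∈ (extChartAt 𝓘(ℂ, E') (h m)).source := ha.1.2
    have hb2 : h ((extChartAt 𝓘(ℂ, E) m).symm b) ∈ (extChartAt 𝓘(ℂ, E') (h m)).source := hb.1.2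
    have h1 : h ((extChartAt 𝓘(ℂ, E) m).symm a) = h ((extChartAt 𝓘(ℂ, E) m).symm b) :=
      (extChartAt 𝓘(ℂ, E') (h m)).injOn ha2 hb2 hab
    rw [he₀] at h1
    have h2 : (extChartAt 𝓘(ℂ, E) m).symm a = (extChartAt 𝓘(ℂ, E) m).symm b := e₀.injOn ha1 hb1 h1
    refine (extChartAt 𝓘(ℂ, E) m).symm.injOn ?_ ?_ h2
    · rw [PartialEquiv.symm_source]; exact ha.1.1
    · rw [PartialEquiv.symm_source]; exact hb.1.1
  -- equal dimensions: `cx.symm ≫ e₀ ≫ cy` is a partial homeomorphism `E ⇀ E'` with non-empty source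
  have hdim : Module.finrank ℂ E = Module.finrank ℂ E' := by
    refine Literature.Topology.Euclidean.Brouwer.finrank_complex_eq_of_openPartialHomeomorph
      (cx.symm.trans (e₀.trans cy)) ⟨cx m, ?_⟩
    simp only [OpenPartialHomeomorph.trans_source, OpenPartialHomeomorph.symm_source, mem_inter_iff, mem_preimage]
    refine ⟨mem_chart_target E m, ?_, ?_⟩
    · rw [hcx, OpenPartialHomeomorph.left_inv _ (mem_chart_source E m)]; exact hme₀
    · rw [hcx, OpenPartialHomeomorph.left_inv _ (mem_chart_source E m), ← he₀, hcy]
      exact mem_chart_source E' (h m)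
  -- Clements–Osgood
  have hbij : Bijective (fderiv ℂ F (extChartAt 𝓘(ℂ, E) m m)) :=
    Literature.Analysis.Complex.SCV.bijective_fderiv_of_injOn hdim hFd' hU'o hFinj hxU'
  -- `mfderiv h m` is that derivative
  have hmf : mfderiv 𝓘(ℂ, E) 𝓘(ℂ, E') h m = fderiv ℂ F (extChartAt 𝓘(ℂ, E) m m) := by
    rw [(hmd m).mfderiv, hF, writtenInExtChartAt, ModelWithCorners.Boundaryless.range_eq_univ, fderivWithin_univ]
  rw [hmf]
  exact hbij

end IsAnalytification

end Literature.NumberTheory.Transcendental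

end
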